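import Summits.ABC.IUTFork.Joshi.TestGenuinePinsLinkPin
import HarnessLib

/-!
# Branch E TEST — THE Y-26 CRITERION FOR ARBITRARY Θ-IDELES: the binder `ht0 : ∀ pp i x, t pp i x ≠ 0` REMOVED (count-neutral hygiene)

Proof-only file (abc-iut cell, D-0079 R-J «Joshi Y-discharge census», row Y-26, E-t42 lineage after E-ROW R-65 / R-70 / R-73; seat abc-iut-E-t42,
gen 9; 0 definitions, 0 instances, no `Prop` fact, FACT rows used: none; everything BY NAME).  The Y-26 criterion object of record
`Joshi.exists_pinnedRegions_settingPrVolSharp_iff_finrank_eq_one` (abc-iut-f-045 p503923; ⟹ p503388, ⟸ abc-iut-E-t41 p463284) carries the side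
binder **`ht0 : ∀ pp i x, t pp i x ≠ 0`** («non-zero Θ-ideles»), entering ONLY through the inhabited side: abc-iut-E-t41's
`GenuinePinsDegOne.thetaRegion_settingPrVolSharp_inr_eq_preimage_hullSet` rewrites the Kummer image `e⁻¹(ι_j(t_{Θ,j})·(R_I)^∼)` as the preimage
of the hull-set `λ·𝒪_L`, `λ = centreOf(ι_j(t_{Θ,j}))`, via abc-iut-c312-3's `PadicPresentation.boxOf_smul_normalizedPacket`, which asks every
component of `λ` to be non-zero.  THIS FILE shows that request is unnecessary — a ZERO component gives the factor `0·(R)^∼ = {0} = closedBall 0 0`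
on both sides — and re-derives the chain without `ht0`:

* §0 `hullSet_eq_image_mul_polydisc` — `λ·𝒪_L = {λ·x : x ∈ 𝒪_L}` for EVERY centre `λ` (Literature's `hullSet_eq_image_mul` minus `∀ j, c j ≠ 0`);
  §1 `preimage_dEquiv_hullSet₀`, **`boxOf_smul_normalizedPacket₀`** (c312-3's lemmas minus the non-degeneracy hypothesis);
* §2 at abc-iut-c312-7's `settingPrVolSharp` over the Y-26 frame: `thetaRegion_settingPrVolSharp_inr_eq_preimage_hullSet₀`,
  `generator_image_thetaRegion_eq₀`, `regions_invariant_of_localDeg_eq_one₀`, **`exists_pinnedRegions_settingPrVolSharp_of_localDeg_eq_one₀`** /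
  `…_of_finrank_eq_one₀` — abc-iut-E-t41's p463284 chain VERBATIM with `ht0` deleted (E-t58's criterion
  `PinsCriteria.exists_pinnedRegions_of_regions_invariant_of_const` BY NAME);
* §3 **`exists_pinnedRegions_settingPrVolSharp_iff_finrank_eq_one₀`** — `(∃ ρ qK, PinnedRegions …) ↔ [F:ℚ] = 1` for ALL Θ-ideles `t` (the
  remaining binders `htq0`/`htq1` are the ones `settingPrVolSharp` itself takes); `forall_not_…_iff_one_lt_finrank₀`; with ★ p524016:
  `exists_pinnedRegions3_…_iff_finrank_eq_one_and_nonempty_equiv₀`, `exists_pinnedRegions3_…_unit_iff_finrank_eq_one₀`.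

READING (tree currency; located, not adjudicated; COUNT-NEUTRAL).  The Y-26 word of record «genuine-carrier pins at `settingPrVolSharp` are
INHABITED ⟺ F = ℚ» thus holds with NO condition on the Θ-ideles; the «non-zero Θ-ideles» proviso of p503923 / p504878 / ★ p524016 §3 is a
proof artefact, not a hypothesis of the phenomenon.  (Print's Θ-pilot ideles are units, hence non-zero — Dupuy–Hilado §3.7; the point is binder
hygiene of OUR criterion, nothing about print.)  **No side is taken** on [IUTchIII] Cor. 3.12 / [IUTchIV] Thm. 1.10 or on any author
(Mochizuki / Scholze–Stix / Joshi / Dupuy–Hilado); typed ≠ proved; instantiated ≠ endorsed; NOT an abc claim. [claim: Mochizuki2012, status: disputed]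
[cite: DupuyHilado2025, §3.7, §3.9, §4.7, §4.9]
-/

noncomputable section

open Set Function NumberField IsDedekindDomain Metric
open scoped Pointwise Classical

namespace Summit.ABC.IUTFork.Joshi

namespace GenuinePinsAnyTheta

open Thm311 Thm311.Real Cor312 Cor312Vol Literature.IUT.LogThetaLattice Literature.IUT.LogVolume
  Literature.IUT.HodgeTheaters Literature.NumberTheory.NumberFields GenuinePinsDegOne GenuinePinsLinkPin

/-! ## 0. `λ·𝒪_L` is the set of products `λ·x`, `x ∈ 𝒪_L`, for EVERY centre `λ` -/

section Hull

variable {J : Type} (K : J → Type) [∀ j, NontriviallyNormedField (K j)]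

/-- `hullSet K c = (c * ·) '' 𝒪_L` with NO non-vanishing condition on the centre `c`: at a component with `c j = 0` both sides are `{0}`
(Literature's `hullSet_eq_image_mul` asks `∀ j, c j ≠ 0`). [cite: Mochizuki2012, IUTchIII Rmk. 3.9.5 (i) p. 127] -/
theorem hullSet_eq_image_mul_polydisc (c : Π j, K j) : hullSet K c = (fun x => c * x) '' polydisc K (fun _ => 1) := by
  ext x
  simp only [hullSet, mem_polydisc, mem_image]
  constructor
  · intro hx
    refine ⟨fun j => if c j = 0 then 0 else (c j)⁻¹ * x j, fun j => ?_, ?_⟩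
    · show ‖(if c j = 0 then 0 else (c j)⁻¹ * x j)‖ ≤ 1
      by_cases hcj : c j = 0
      · rw [if_pos hcj, norm_zero]; exact zero_le_one
      · rw [if_neg hcj, norm_mul, norm_inv, inv_mul_le_iff₀ (norm_pos_iff.mpr hcj), mul_one]
        exact hx j
    · funext j
      by_cases hcj : c j = 0
      · have hx0 : x j = 0 := by simpa [hcj] using hx j
        simp [Pi.mul_apply, hcj, hx0]
      · simp [Pi.mul_apply, hcj]
  · rintro ⟨y, hy, rfl⟩ j
    rw [Pi.mul_apply, norm_mul]
    exact mul_le_of_le_one_right (norm_nonneg _) (hy j)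

end Hull

/-! ## 1. abc-iut-c312-3's box lemmas without the non-degeneracy hypothesis -/

section Presentation

variable {T : ThetaIndex} {L : LogShells T} {vQ : T.VQ} {p : ℕ} [Fact p.Prime] (P : Cor312Vol.PadicPresentation L vQ p)

/-- `ψ_{v⃗}⁻¹(ψ_{v⃗}(g)·𝒪) = g·(R_I)^∼` for EVERY `g` (c312-3's `preimage_dEquiv_hullSet` minus `∀ i, ψ(g)_i ≠ 0`).
[cite: Mochizuki2012, IUTchIV Prop. 1.4 (i) p. 13] -/
theorem preimage_dEquiv_hullSet₀ {j : T.Label} (e : T.Caps j → T.Fibre vQ) (g : P.X e) :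
    dEquiv p (P.kk e) ⁻¹' hullSet (DFac p (P.kk e)) (dEquiv p (P.kk e) g) = g • (normalizedPacket p (P.kk e) : Set (P.X e)) := by
  haveI : Nonempty (T.Caps j) := ⟨0⟩
  rw [← Set.preimage_image_eq (g • (normalizedPacket p (P.kk e) : Set (P.X e))) (dEquiv p (P.kk e)).injective,
    image_smul_eq, image_normalizedPacket_eq_coe, coe_piUnitBallStructure, hullSet_eq_image_mul_polydisc]

/-- **`boxOf (g_{v⃗}·(R_I)^∼)_{v⃗} = λ·𝒪_L`, `λ = centreOf g`, for EVERY family `g`** (c312-3's `boxOf_smul_normalizedPacket` minus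
`∀ e i, ψ(g_e)_i ≠ 0`). [cite: Mochizuki2012, IUTchIII Rmk. 3.9.5 (ii) p. 127] -/
theorem boxOf_smul_normalizedPacket₀ {j : T.Label} (g : ∀ e : T.Caps j → T.Fibre vQ, P.X e) :
    P.boxOf (fun e => g e • (normalizedPacket p (P.kk e) : Set (P.X e))) = hullSet (P.factorField j) (P.centreOf g) := by
  ext y
  simp only [PadicPresentation.boxOf, Set.mem_setOf_eq, hullSet, mem_polydisc, Sigma.forall]
  refine forall_congr' fun e => ?_
  have hpre := preimage_dEquiv_hullSet₀ P e (g e)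
  rw [hullSet] at hpre
  rw [← hpre]
  constructor
  · rintro ⟨x, hx, hy⟩ i
    rw [hy i]
    exact (mem_polydisc _).1 hx i
  · intro hy
    refine ⟨(dEquiv p (P.kk e)).symm fun i => y ⟨e, i⟩, ?_, fun i => ?_⟩
    · rw [Set.mem_preimage, AlgEquiv.apply_symm_apply]
      exact (mem_polydisc _).2 hy
    · rw [AlgEquiv.apply_symm_apply]

end Presentation

/-! ## 2. The inhabited side of Y-26 for arbitrary Θ-ideles -/

section Genuine

variable {F : Type} [Field F] [NumberField F] (X : PilotData F)
  (M : Type) [Field M] [NumberField M]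
  (archPk : ∀ (j : (thetaIndex X).Label) (vQ : (thetaIndex X).VQ), Set ((logShellsDH X (analyticLogv F)).Packet j vQ))
  (archSub : ∀ (j : (thetaIndex X).Label) (v : (thetaIndex X).V),
    Set ((logShellsDH X (analyticLogv F)).Packet j ((thetaIndex X).over v)))
  (Ψ : ℤ → ∀ v : (thetaIndex X).V, v ∈ (thetaIndex X).Vbad → Set ((logShellsDH X (analyticLogv F)).StarPacket v))
  (act : ℤ → ∀ v : (thetaIndex X).V, v ∈ (thetaIndex X).Vbad →
    (logShellsDH X (analyticLogv F)).StarPacket v → Module.End ℚ ((logShellsDH X (analyticLogv F)).StarPacket v))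
  (Mmod : ℤ → ∀ j : (thetaIndex X).LabelStar, Set ((logShellsDH X (analyticLogv F)).GlobalPacket j.1))
  (region : ℤ → ∀ j : (thetaIndex X).LabelStar, FinDivisor M → ∀ vQ : (thetaIndex X).VQ,
    Set ((logShellsDH X (analyticLogv F)).Packet j.1 vQ))
  (frobAdm : ℤ → ℤ → ∀ (j : (thetaIndex X).Label) (vQ : (thetaIndex X).VQ),
    Set ((logShellsDH X (analyticLogv F)).Packet j vQ) → Prop)
  (frobLogvol : ℤ → ℤ → ∀ (j : (thetaIndex X).Label) (vQ : (thetaIndex X).VQ),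
    Set ((logShellsDH X (analyticLogv F)).Packet j vQ) → ℝ)
  (frobΨ : ℤ → ℤ → ∀ v : (thetaIndex X).V, v ∈ (thetaIndex X).Vbad → Set ((logShellsDH X (analyticLogv F)).StarPacket v))
  (frobMmod : ℤ → ℤ → ∀ j : (thetaIndex X).LabelStar, Set ((logShellsDH X (analyticLogv F)).GlobalPacket j.1))
  (unitImage : ℤ → ℤ → ℕ → ∀ (j : (thetaIndex X).Label) (vQ : (thetaIndex X).VQ),
    Set ((logShellsDH X (analyticLogv F)).Packet j vQ))
  (ballImage : ℤ → ℤ → ∀ (j : (thetaIndex X).Label) (vQ : (thetaIndex X).VQ),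
    Set ((logShellsDH X (analyticLogv F)).Packet j vQ))
  (thetaDiv : ℤ → ℤ → LgpDivisor M (thetaIndex X).lstar)
  (n : ℤ) {HT : Type} {LogLink : HT → HT → Type} {IsFull : ∀ {s t : HT}, LogLink s t → Prop}
  (lat : LGPGaussianLogThetaLattice LogLink IsFull)
  {Frd : Type} {IsoF : Frd → Frd → Type} {Ob : Frd → Type} {realify : Frd → Frd} {Strip : Type}
  {IsoS : Strip → Strip → Type} {Mv : ∀ v : (thetaIndex X).V, v ∈ (thetaIndex X).Vbad → Type}
  [∀ v h, Monoid (Mv v h)]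
  (sig : GlobalLGPFrobenioidSignature (thetaIndex X).lstar (thetaIndex X).V (· ∈ (thetaIndex X).Vbad)
    Frd IsoF Ob realify Strip IsoS Mv)
  (split : SplittingMonoids Mv) {ObΔ : Type} {N : ∀ v : (thetaIndex X).V, v ∈ (thetaIndex X).Vbad → Type}
  [∀ v h, Monoid (N v h)] (qData : QPilotData ObΔ N)
  (tq : ∀ (pp : Nat.Primes) (x : (thetaIndex X).Fibre (.inr pp)), haveI : Fact (pp : ℕ).Prime := ⟨pp.2⟩; kOf X pp.1 x)
  (htq0 : ∀ pp x, tq pp x ≠ 0)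
  (htq1 : ∀ (pp : Nat.Primes) (x : (thetaIndex X).Fibre (.inr pp)),
    haveI : Fact (pp : ℕ).Prime := ⟨pp.2⟩; placeOf X pp.1 x ∉ X.S → ‖tq pp x‖ = 1)

/-- **Every Kummer image of the Θ-pilot object at a prime packet is the preimage of a hull-set — for ARBITRARY Θ-ideles** (abc-iut-E-t41's
`thetaRegion_settingPrVolSharp_inr_eq_preimage_hullSet` minus `ht0`, via `boxOf_smul_normalizedPacket₀`). [cite: DupuyHilado2025, §3.7, §3.9] -/
theorem thetaRegion_settingPrVolSharp_inr_eq_preimage_hullSet₀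
    (t : ∀ (pp : Nat.Primes) (_ : Fin X.lstar) (x : (thetaIndex X).Fibre (.inr pp)), haveI : Fact (pp : ℕ).Prime := ⟨pp.2⟩; kOf X pp.1 x)
    (m : ℤ) (j : (thetaIndex X).Label) (pp : Nat.Primes) :
    haveI : Fact (pp : ℕ).Prime := ⟨pp.2⟩
    (settingPrVolSharp X (logvAnalytic_analyticLogv (F := F)) M archPk archSub Ψ act Mmod region n lat sig split qData tq t
        htq0 htq1).thetaRegion m j (.inr pp) =
      factorMapDH X (logvAnalytic_analyticLogv (F := F)) j (.inr pp) ⁻¹'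
        hullSet (factorFieldDH X (logvAnalytic_analyticLogv (F := F)) j (.inr pp))
          ((presAt X (logvAnalytic_analyticLogv (F := F)) pp).centreOf fun e =>
            iota pp.1 ((presAt X (logvAnalytic_analyticLogv (F := F)) pp).kk e) (Fin.last _)
              (labelIdele X t pp j (e (Fin.last _)))) := by
  haveI : Fact (pp : ℕ).Prime := ⟨pp.2⟩
  have hlog : LogvAnalytic (analyticLogv F) := logvAnalytic_analyticLogv (F := F)
  show (fun x => (presAt X hlog pp).factorMap j x) ⁻¹' (presAt X hlog pp).boxOf (sharpBoxDH X hlog t pp j) = _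
  have hbox : sharpBoxDH X hlog t pp j = fun e =>
      iota pp.1 ((presAt X hlog pp).kk e) (Fin.last _) (labelIdele X t pp j (e (Fin.last _))) •
        (normalizedPacket pp.1 ((presAt X hlog pp).kk e) : Set ((presAt X hlog pp).X e)) := rfl
  rw [hbox, boxOf_smul_normalizedPacket₀]
  rfl

/-- **Every generator fixes every Kummer image of the Θ-pilot object — arbitrary Θ-ideles** (one place per prime, local degree one; E-t41's
`generator_image_thetaRegion_eq` minus `ht0`). [cite: DupuyHilado2025, §3.9, §4.7, §4.9] -/
theorem generator_image_thetaRegion_eq₀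
    (t : ∀ (pp : Nat.Primes) (_ : Fin X.lstar) (x : (thetaIndex X).Fibre (.inr pp)), haveI : Fact (pp : ℕ).Prime := ⟨pp.2⟩; kOf X pp.1 x)
    (hfib : ∀ pp : Nat.Primes, Subsingleton ((thetaIndex X).Fibre (.inr pp)))
    (hdeg : ∀ v : HeightOneSpectrum (𝓞 F), localDeg F v = 1)
    {Φ : (logShellsDH X (analyticLogv F)).PacketAut}
    (hΦ : Φ ∈ (logShellsDH X (analyticLogv F)).Ind1Family ∪ (logShellsDH X (analyticLogv F)).Ind2Family)
    (m : ℤ) (j : (thetaIndex X).Label) (vQ : (thetaIndex X).VQ) :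
    Φ j vQ '' (settingPrVolSharp X (logvAnalytic_analyticLogv (F := F)) M archPk archSub Ψ act Mmod region n lat sig split
        qData tq t htq0 htq1).thetaRegion m j vQ =
      (settingPrVolSharp X (logvAnalytic_analyticLogv (F := F)) M archPk archSub Ψ act Mmod region n lat sig split qData tq t
        htq0 htq1).thetaRegion m j vQ := by
  rcases vQ with u | pp
  · rw [thetaRegion_settingPrVolSharp_inl]
    exact Set.image_univ_of_surjective (Φ j (.inl u)).surjective
  · obtain ⟨g, hg, hcomm⟩ := generator_factorMapDH_isometric_of_localDeg_eq_one X hfib hdeg hΦ j (.inr pp)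
    rw [thetaRegion_settingPrVolSharp_inr_eq_preimage_hullSet₀ X M archPk archSub Ψ act Mmod region n lat sig split qData tq
      htq0 htq1 t m j pp]
    exact Cor312Vol.image_preimage_hullSet_of_downstairs_isometries (Φ j (.inr pp)).surjective g hg hcomm _

/-- **Every element of `⟨(Ind1) ∪ (Ind2)⟩` fixes every Θ-region and the q-region — arbitrary Θ-ideles** (E-t41's
`regions_invariant_of_localDeg_eq_one` minus `ht0`). [cite: DupuyHilado2025, §4.7, §4.9] -/
theorem regions_invariant_of_localDeg_eq_one₀
    (t : ∀ (pp : Nat.Primes) (_ : Fin X.lstar) (x : (thetaIndex X).Fibre (.inr pp)), haveI : Fact (pp : ℕ).Prime := ⟨pp.2⟩; kOf X pp.1 x)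
    (hfib : ∀ pp : Nat.Primes, Subsingleton ((thetaIndex X).Fibre (.inr pp)))
    (hdeg : ∀ v : HeightOneSpectrum (𝓞 F), localDeg F v = 1)
    {Φ : (logShellsDH X (analyticLogv F)).PacketAut}
    (hΦ : Φ ∈ Subgroup.closure
      ((logShellsDH X (analyticLogv F)).Ind1Family ∪ (logShellsDH X (analyticLogv F)).Ind2Family))
    (m : ℤ) (j : (thetaIndex X).Label) (vQ : (thetaIndex X).VQ) :
    Φ j vQ '' (settingPrVolSharp X (logvAnalytic_analyticLogv (F := F)) M archPk archSub Ψ act Mmod region n lat sig split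
          qData tq t htq0 htq1).thetaRegion m j vQ =
        (settingPrVolSharp X (logvAnalytic_analyticLogv (F := F)) M archPk archSub Ψ act Mmod region n lat sig split qData tq t
          htq0 htq1).thetaRegion m j vQ ∧
      Φ j vQ '' (settingPrVolSharp X (logvAnalytic_analyticLogv (F := F)) M archPk archSub Ψ act Mmod region n lat sig split
          qData tq t htq0 htq1).qRegion j vQ =
        (settingPrVolSharp X (logvAnalytic_analyticLogv (F := F)) M archPk archSub Ψ act Mmod region n lat sig split qData tq t
          htq0 htq1).qRegion j vQ :=
  ⟨image_eq_of_mem_closure (logShellsDH X (analyticLogv F)) _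
      (fun _ hΦ' => generator_image_thetaRegion_eq₀ X M archPk archSub Ψ act Mmod region n lat sig split qData tq htq0 htq1 t
        hfib hdeg hΦ' m j vQ) hΦ,
    image_eq_of_mem_closure (logShellsDH X (analyticLogv F)) _
      (fun _ hΦ' => generator_image_qRegion_eq X M archPk archSub Ψ act Mmod region n lat sig split qData t tq htq0 htq1
        hfib hdeg hΦ' j vQ) hΦ⟩

/-- **Y-26 POSITIVE HALF for ARBITRARY Θ-ideles** — at ℚ's local shape (one place per prime, local degree one) the genuine-carrier pins
`(hρ) ∧ (pΘ) ∧ (pq′)` ARE INHABITED for every pilot datum, every context binder, EVERY Θ-ideles `t` (zero coordinates allowed) and every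
q-ideles `tq` the setting accepts (E-t41's p463284 theorem minus `ht0`; E-t58's criterion BY NAME; the witness `(ρ, qK)` is junk).
[claim: Mochizuki2012, status: disputed] [cite: DupuyHilado2025, §3.9, §4.7, §4.9] -/
theorem exists_pinnedRegions_settingPrVolSharp_of_localDeg_eq_one₀
    (t : ∀ (pp : Nat.Primes) (_ : Fin X.lstar) (x : (thetaIndex X).Fibre (.inr pp)), haveI : Fact (pp : ℕ).Prime := ⟨pp.2⟩; kOf X pp.1 x)
    (hfib : ∀ pp : Nat.Primes, Subsingleton ((thetaIndex X).Fibre (.inr pp)))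
    (hdeg : ∀ v : HeightOneSpectrum (𝓞 F), localDeg F v = 1) :
    ∃ (ρ : (∀ v : (thetaIndex X).V, v ∈ (thetaIndex X).Vbad → Set ((logShellsDH X (analyticLogv F)).StarPacket v)) →
          ∀ (j : (thetaIndex X).Label) (vQ : (thetaIndex X).VQ), Set ((logShellsDH X (analyticLogv F)).Packet j vQ))
      (qK : ∀ v : (thetaIndex X).V, v ∈ (thetaIndex X).Vbad → Set ((logShellsDH X (analyticLogv F)).StarPacket v)),
      Cor312Vol.PinnedRegions
        (LatticeSituation.ofShells (logShellsDH X (analyticLogv F)) M archPk archSub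
          (summandPiecesPr X (logvAnalytic_analyticLogv (F := F))).Adm
          (summandPiecesPr X (logvAnalytic_analyticLogv (F := F))).logvol Ψ act Mmod region frobAdm frobLogvol frobΨ frobMmod
          unitImage ballImage thetaDiv)
        (settingPrVolSharp X (logvAnalytic_analyticLogv (F := F)) M archPk archSub Ψ act Mmod region n lat sig split qData tq t
          htq0 htq1) ρ qK := by
  obtain ⟨v, hv⟩ := X.S_nonempty
  have hv₀ : (Sum.inr v : (thetaIndex X).V) ∈ (thetaIndex X).Vbad := ⟨v, hv, rfl⟩
  obtain ⟨e, he⟩ := exists_injective_int_starPacket X stripAutDH (ismDH (analyticLogv F)) refl_mem_stripAutDH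
    (refl_mem_ismDH (analyticLogv F)) (logv := analyticLogv F) (Sum.inr v : (thetaIndex X).V)
  have hw : ∃ w : (logShellsDH X (analyticLogv F)).StarPacket (Sum.inr v : (thetaIndex X).V), w ≠ 0 := by
    by_cases h0 : e 0 = 0
    · exact ⟨e 1, fun h1 => one_ne_zero (he (h1.trans h0.symm))⟩
    · exact ⟨e 0, h0⟩
  obtain ⟨w, hw⟩ := hw
  exact PinsCriteria.exists_pinnedRegions_of_regions_invariant_of_const
    (LatticeSituation.ofShells (logShellsDH X (analyticLogv F)) M archPk archSub
      (summandPiecesPr X (logvAnalytic_analyticLogv (F := F))).Adm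
      (summandPiecesPr X (logvAnalytic_analyticLogv (F := F))).logvol Ψ act Mmod region frobAdm frobLogvol frobΨ frobMmod
      unitImage ballImage thetaDiv)
    (settingPrVolSharp X (logvAnalytic_analyticLogv (F := F)) M archPk archSub Ψ act Mmod region n lat sig split qData tq t
      htq0 htq1) hv₀ hw
    (fun Φ hΦ m j vQ => (regions_invariant_of_localDeg_eq_one₀ X M archPk archSub Ψ act Mmod region n lat sig split qData tq htq0
      htq1 t hfib hdeg hΦ m j vQ).1)
    (fun Φ hΦ j vQ => (regions_invariant_of_localDeg_eq_one₀ X M archPk archSub Ψ act Mmod region n lat sig split qData tq htq0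
      htq1 t hfib hdeg hΦ 0 j vQ).2)
    (fun m j vQ => rfl)

/-- **`[F : ℚ] = 1` ⟹ INHABITED, for arbitrary Θ-ideles** (w5-d216's `subsingleton_fibre_of_finrank_eq_one` / `localDeg_eq_one_of_finrank_eq_one`).
[claim: Mochizuki2012, status: disputed] -/
theorem exists_pinnedRegions_settingPrVolSharp_of_finrank_eq_one₀
    (t : ∀ (pp : Nat.Primes) (_ : Fin X.lstar) (x : (thetaIndex X).Fibre (.inr pp)), haveI : Fact (pp : ℕ).Prime := ⟨pp.2⟩; kOf X pp.1 x)
    (hF : Module.finrank ℚ F = 1) :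
    ∃ (ρ : (∀ v : (thetaIndex X).V, v ∈ (thetaIndex X).Vbad → Set ((logShellsDH X (analyticLogv F)).StarPacket v)) →
          ∀ (j : (thetaIndex X).Label) (vQ : (thetaIndex X).VQ), Set ((logShellsDH X (analyticLogv F)).Packet j vQ))
      (qK : ∀ v : (thetaIndex X).V, v ∈ (thetaIndex X).Vbad → Set ((logShellsDH X (analyticLogv F)).StarPacket v)),
      Cor312Vol.PinnedRegions
        (LatticeSituation.ofShells (logShellsDH X (analyticLogv F)) M archPk archSub
          (summandPiecesPr X (logvAnalytic_analyticLogv (F := F))).Adm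
          (summandPiecesPr X (logvAnalytic_analyticLogv (F := F))).logvol Ψ act Mmod region frobAdm frobLogvol frobΨ frobMmod
          unitImage ballImage thetaDiv)
        (settingPrVolSharp X (logvAnalytic_analyticLogv (F := F)) M archPk archSub Ψ act Mmod region n lat sig split qData tq t
          htq0 htq1) ρ qK :=
  exists_pinnedRegions_settingPrVolSharp_of_localDeg_eq_one₀ X M archPk archSub Ψ act Mmod region frobAdm frobLogvol frobΨ
    frobMmod unitImage ballImage thetaDiv n lat sig split qData tq htq0 htq1 t (subsingleton_fibre_of_finrank_eq_one X hF)
    (localDeg_eq_one_of_finrank_eq_one hF)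

/-! ## 3. The Y-26 criterion and its companions, all Θ-ideles -/

/-- **THE Y-26 CRITERION FOR ARBITRARY Θ-IDELES: `(∃ ρ qK, PinnedRegions … settingPrVolSharp …) ↔ [F:ℚ] = 1`** — EMPTY side = p503388
(`finrank_eq_one_of_pinnedRegions_settingPrVolSharp`, never needed `ht0`), INHABITED side = §2; the binder `ht0` of p503923 is gone.
[claim: Mochizuki2012, status: disputed] [cite: DupuyHilado2025, §4.9] -/
theorem exists_pinnedRegions_settingPrVolSharp_iff_finrank_eq_one₀
    (t : ∀ (pp : Nat.Primes) (_ : Fin X.lstar) (x : (thetaIndex X).Fibre (.inr pp)), haveI : Fact (pp : ℕ).Prime := ⟨pp.2⟩; kOf X pp.1 x) :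
    (∃ (ρ : (∀ v : (thetaIndex X).V, v ∈ (thetaIndex X).Vbad → Set ((logShellsDH X (analyticLogv F)).StarPacket v)) →
          ∀ (j : (thetaIndex X).Label) (vQ : (thetaIndex X).VQ), Set ((logShellsDH X (analyticLogv F)).Packet j vQ))
      (qK : ∀ v : (thetaIndex X).V, v ∈ (thetaIndex X).Vbad → Set ((logShellsDH X (analyticLogv F)).StarPacket v)),
      Cor312Vol.PinnedRegions
        (LatticeSituation.ofShells (logShellsDH X (analyticLogv F)) M archPk archSub
          (summandPiecesPr X (logvAnalytic_analyticLogv (F := F))).Adm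
          (summandPiecesPr X (logvAnalytic_analyticLogv (F := F))).logvol Ψ act Mmod region frobAdm frobLogvol frobΨ frobMmod
          unitImage ballImage thetaDiv)
        (settingPrVolSharp X (logvAnalytic_analyticLogv (F := F)) M archPk archSub Ψ act Mmod region n lat sig split qData tq t
          htq0 htq1) ρ qK) ↔
      Module.finrank ℚ F = 1 :=
  ⟨fun ⟨ρ, qK, h⟩ => finrank_eq_one_of_pinnedRegions_settingPrVolSharp X M archPk archSub Ψ act Mmod region frobAdm frobLogvol frobΨ
      frobMmod unitImage ballImage thetaDiv n lat sig split qData t tq ρ qK htq0 htq1 h,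
    fun hF => exists_pinnedRegions_settingPrVolSharp_of_finrank_eq_one₀ X M archPk archSub Ψ act Mmod region frobAdm frobLogvol frobΨ
      frobMmod unitImage ballImage thetaDiv n lat sig split qData tq htq0 htq1 t hF⟩

/-- **Negated form, arbitrary Θ-ideles**: `(∀ ρ qK, ¬ PinnedRegions …) ↔ 1 < [F:ℚ]`. [claim: Mochizuki2012, status: disputed] -/
theorem forall_not_pinnedRegions_settingPrVolSharp_iff_one_lt_finrank₀
    (t : ∀ (pp : Nat.Primes) (_ : Fin X.lstar) (x : (thetaIndex X).Fibre (.inr pp)), haveI : Fact (pp : ℕ).Prime := ⟨pp.2⟩; kOf X pp.1 x) :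
    (∀ (ρ : (∀ v : (thetaIndex X).V, v ∈ (thetaIndex X).Vbad → Set ((logShellsDH X (analyticLogv F)).StarPacket v)) →
          ∀ (j : (thetaIndex X).Label) (vQ : (thetaIndex X).VQ), Set ((logShellsDH X (analyticLogv F)).Packet j vQ))
      (qK : ∀ v : (thetaIndex X).V, v ∈ (thetaIndex X).Vbad → Set ((logShellsDH X (analyticLogv F)).StarPacket v)),
      ¬ Cor312Vol.PinnedRegions
        (LatticeSituation.ofShells (logShellsDH X (analyticLogv F)) M archPk archSub
          (summandPiecesPr X (logvAnalytic_analyticLogv (F := F))).Adm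
          (summandPiecesPr X (logvAnalytic_analyticLogv (F := F))).logvol Ψ act Mmod region frobAdm frobLogvol frobΨ frobMmod
          unitImage ballImage thetaDiv)
        (settingPrVolSharp X (logvAnalytic_analyticLogv (F := F)) M archPk archSub Ψ act Mmod region n lat sig split qData tq t
          htq0 htq1) ρ qK) ↔
      1 < Module.finrank ℚ F := by
  have h := (exists_pinnedRegions_settingPrVolSharp_iff_finrank_eq_one₀ X M archPk archSub Ψ act Mmod region frobAdm frobLogvol frobΨ
    frobMmod unitImage ballImage thetaDiv n lat sig split qData tq htq0 htq1 t).not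
  simp only [not_exists] at h
  have hpos : 0 < Module.finrank ℚ F := Module.finrank_pos
  rw [h]; omega

/-- **Three-pin form, arbitrary Θ-ideles** (with ★ p524016 §1): `(∃ ρ qK, PinnedRegions3 …) ↔ [F:ℚ] = 1 ∧ Nonempty (Ob sig.Clgp ≃ ObΔ)`.
[claim: Mochizuki2012, status: disputed] -/
theorem exists_pinnedRegions3_settingPrVolSharp_iff_finrank_eq_one_and_nonempty_equiv₀
    (t : ∀ (pp : Nat.Primes) (_ : Fin X.lstar) (x : (thetaIndex X).Fibre (.inr pp)), haveI : Fact (pp : ℕ).Prime := ⟨pp.2⟩; kOf X pp.1 x) :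
    (∃ (ρ : (∀ v : (thetaIndex X).V, v ∈ (thetaIndex X).Vbad → Set ((logShellsDH X (analyticLogv F)).StarPacket v)) →
          ∀ (j : (thetaIndex X).Label) (vQ : (thetaIndex X).VQ), Set ((logShellsDH X (analyticLogv F)).Packet j vQ))
      (qK : ∀ v : (thetaIndex X).V, v ∈ (thetaIndex X).Vbad → Set ((logShellsDH X (analyticLogv F)).StarPacket v)),
      Cor312Vol.PinnedRegions3
        (LatticeSituation.ofShells (logShellsDH X (analyticLogv F)) M archPk archSub
          (summandPiecesPr X (logvAnalytic_analyticLogv (F := F))).Adm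
          (summandPiecesPr X (logvAnalytic_analyticLogv (F := F))).logvol Ψ act Mmod region frobAdm frobLogvol frobΨ frobMmod
          unitImage ballImage thetaDiv)
        (settingPrVolSharp X (logvAnalytic_analyticLogv (F := F)) M archPk archSub Ψ act Mmod region n lat sig split qData tq t
          htq0 htq1) ρ qK) ↔
      Module.finrank ℚ F = 1 ∧ Nonempty (Ob sig.Clgp ≃ ObΔ) := by
  constructor
  · rintro ⟨ρ, qK, hpin, hL⟩
    exact ⟨(exists_pinnedRegions_settingPrVolSharp_iff_finrank_eq_one₀ X M archPk archSub Ψ act Mmod region frobAdm frobLogvol frobΨ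
        frobMmod unitImage ballImage thetaDiv n lat sig split qData tq htq0 htq1 t).1 ⟨ρ, qK, hpin⟩,
      (linkPinned_settingPrVolSharp_ofShells_iff X M archPk archSub Ψ act Mmod region frobAdm frobLogvol frobΨ frobMmod unitImage
        ballImage thetaDiv n lat sig split qData t tq htq0 htq1).1 hL⟩
  · rintro ⟨hF, ⟨e⟩⟩
    obtain ⟨ρ, qK, hpin⟩ := (exists_pinnedRegions_settingPrVolSharp_iff_finrank_eq_one₀ X M archPk archSub Ψ act Mmod region frobAdm
      frobLogvol frobΨ frobMmod unitImage ballImage thetaDiv n lat sig split qData tq htq0 htq1 t).2 hF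
    exact ⟨ρ, qK, hpin, (linkPinned_settingPrVolSharp_ofShells_iff X M archPk archSub Ψ act Mmod region frobAdm frobLogvol frobΨ
      frobMmod unitImage ballImage thetaDiv n lat sig split qData t tq htq0 htq1).2 ⟨e⟩⟩

/-- **Three-pin form at the one-point context data, arbitrary Θ-ideles**: `(∃ ρ qK, PinnedRegions3 …) ↔ [F:ℚ] = 1`, hypothesis-free.
[claim: Mochizuki2012, status: disputed] -/
theorem exists_pinnedRegions3_settingPrVolSharp_unit_iff_finrank_eq_one₀
    (t : ∀ (pp : Nat.Primes) (_ : Fin X.lstar) (x : (thetaIndex X).Fibre (.inr pp)), haveI : Fact (pp : ℕ).Prime := ⟨pp.2⟩; kOf X pp.1 x) :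
    (∃ (ρ : (∀ v : (thetaIndex X).V, v ∈ (thetaIndex X).Vbad → Set ((logShellsDH X (analyticLogv F)).StarPacket v)) →
          ∀ (j : (thetaIndex X).Label) (vQ : (thetaIndex X).VQ), Set ((logShellsDH X (analyticLogv F)).Packet j vQ))
      (qK : ∀ v : (thetaIndex X).V, v ∈ (thetaIndex X).Vbad → Set ((logShellsDH X (analyticLogv F)).StarPacket v)),
      Cor312Vol.PinnedRegions3
        (LatticeSituation.ofShells (logShellsDH X (analyticLogv F)) M archPk archSub
          (summandPiecesPr X (logvAnalytic_analyticLogv (F := F))).Adm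
          (summandPiecesPr X (logvAnalytic_analyticLogv (F := F))).logvol Ψ act Mmod region frobAdm frobLogvol frobΨ frobMmod
          unitImage ballImage thetaDiv)
        (settingPrVolSharp X (logvAnalytic_analyticLogv (F := F)) M archPk archSub Ψ act Mmod region n lat (unitSigDH X)
          (unitSplitDH X) (unitQDataDH X) tq t htq0 htq1) ρ qK) ↔
      Module.finrank ℚ F = 1 := by
  rw [exists_pinnedRegions3_settingPrVolSharp_iff_finrank_eq_one_and_nonempty_equiv₀]
  exact ⟨fun h => h.1, fun h => ⟨h, ⟨Equiv.refl Unit⟩⟩⟩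

end Genuine

end GenuinePinsAnyTheta

end Summit.ABC.IUTFork.Joshi

end
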